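import Summits.Ventures.PercRepro.Night2RigidNoLoss

/-!
# PercRepro — the rigid cell: a pair loses at most `λ` at a covering set (night-2, gen 18)

In the rigid cell (`|E ∖ G| = q − 1`, `kColoops = q − 2`, `M` simple) the thin members with a loss are the PAIRS
`B = K ∪ {x, y}` (`loss_eq_zero_of_three_le`).  At a covering set `B ∪ {z}` (a triangle over `K`) every thin
covering preimage is `B ∪ {z} ∖ w` for some `w ∈ {x, y, z}` (`coverPreimages_thin_subset_image_pair`: the deleted
element is not a coloop of `M|G` since thin members contain `K`), so `L1 (B ∪ {z}) ≤ 3Φ/(q+1)`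
(`L1_insert_le_three`), and with `capS ≥ c = (q+4)/(q(q+1))` the loss of `B` at `z` is at most
`λ = Φ/(q+1) − c/3 = (2q²+q−4)/(3q(q+1)²)` (**`loss_le_lambda`**, paper §7).
-/

namespace PercRepro.Shadow

open Finset PerFlat ThmH

variable {α : Type*} [DecidableEq α] {M : Matroid α} [M.Finite]

/-- The loss bound of the rigid cell: `λ = Φ/(q+1) − c/3`. -/
noncomputable def lambdaR (q : ℕ) : ℚ :=
  phiQ q / ((q : ℚ) + 1) - ((q : ℚ) + 4) / ((q : ℚ) * ((q : ℚ) + 1)) / 3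

/-- A thin member has request at most `Φ/(q+1)` when `|E ∖ G| = q − 1`. -/
theorem req_le_of_thin {q : ℕ} {G : Finset α} (hG : G ∈ flatsQ M (q + 1)) (hd : (gr M \ G).card = q - 1)
    {B : Finset α} (hB : B ∈ thinMembers M q G) : req M q B ≤ phiQ q / ((q : ℚ) + 1) := by
  have hd' : (gr M \ G).card ≤ q := by omega
  have hB' : B ∈ membersIn M (Uq M (q + 2) q) G := (mem_thinMembers.1 hB).1
  have hBG : clF M B ⊆ G := (mem_membersIn.1 hB').2
  have hm := two_le_card_sdiff_of_not_lay0 hG hd' hB' (mem_thinMembers.1 hB).2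
  unfold req
  have hc : (q : ℚ) + 1 ≤ ((gr M \ clF M B).card : ℚ) := by
    rw [card_compl_clF_add hG hBG, hd]
    have : q + 1 ≤ (G \ clF M B).card + (q - 1) := by omega
    exact_mod_cast this
  exact div_le_div_of_nonneg_left (phiQ_pos q).le (by positivity) hc

open scoped Classical in
/-- Every thin covering preimage of `B ∪ {z}` is `(B ∪ {z}) ∖ w` for some `w ∈ (B ∖ K) ∪ {z}`. -/
theorem coverPreimages_thin_subset_image {q : ℕ} {G : Finset α} (hG : G ∈ flatsQ M (q + 1))
    (hd : (gr M \ G).card ≤ q) (B : Finset α) (z : α) :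
    (coverPreimages M (Uq M (q + 2) q) G (insert z B)).filter (fun B' => B' ∉ lay0 M q G) ⊆
      (insert z (B \ coloops M G)).image (fun w => (insert z B).erase w) := by
  intro B' hB'
  rw [Finset.mem_filter, mem_coverPreimages] at hB'
  obtain ⟨⟨hB'm, hcov⟩, hB'0⟩ := hB'
  obtain ⟨z', hz', hzz'⟩ := mem_coverSets.1 hcov
  have hB'U : B' ∈ Uq M (q + 2) q := (mem_membersIn.1 hB'm).1
  have hz'B' : z' ∉ B' := notMem_of_notMem_clF hB'U (Finset.mem_sdiff.1 hz').2
  have hB't : B' ∈ thinMembers M q G := mem_thinMembers.2 ⟨hB'm, hB'0⟩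
  have hz'K : z' ∉ coloops M G := fun h => hz'B' (coloops_subset_of_mem_thinMembers hG hd hB't h)
  rw [Finset.mem_image]
  refine ⟨z', ?_, ?_⟩
  · rw [Finset.mem_insert, Finset.mem_sdiff]
    by_cases hzz : z' = z
    · exact Or.inl hzz
    · right
      refine ⟨?_, hz'K⟩
      have : z' ∈ insert z B := by rw [← hzz']; exact Finset.mem_insert_self _ _
      rw [Finset.mem_insert] at this
      exact this.resolve_left hzz
  · rw [← hzz', Finset.erase_insert hz'B']

open scoped Classical in
/-- `L1 (B ∪ {z}) ≤ (|B ∖ K| + 1) · Φ/(q+1)` for a thin member in the regime `|E ∖ G| = q − 1`. -/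
theorem L1_insert_le {q : ℕ} {G : Finset α} (hG : G ∈ flatsQ M (q + 1)) (hd : (gr M \ G).card = q - 1)
    {B : Finset α} (hB : B ∈ thinMembers M q G) {z : α} (hz : z ∈ G \ clF M B) :
    L1 M q G (insert z B) ≤ (((B \ coloops M G).card : ℚ) + 1) * (phiQ q / ((q : ℚ) + 1)) := by
  have hd' : (gr M \ G).card ≤ q := by omega
  have hB' : B ∈ membersIn M (Uq M (q + 2) q) G := (mem_thinMembers.1 hB).1
  have hBU : B ∈ Uq M (q + 2) q := (mem_membersIn.1 hB').1
  have hzB : z ∉ B := notMem_of_notMem_clF hBU (Finset.mem_sdiff.1 hz).2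
  unfold L1
  -- every term is ≤ Φ/(q+1), and the index set injects into (B ∖ K) ∪ {z}
  have hterm : ∀ B' ∈ (coverPreimages M (Uq M (q + 2) q) G (insert z B)).filter (fun B' => B' ∉ lay0 M q G),
      req M q B' ≤ phiQ q / ((q : ℚ) + 1) := by
    intro B' hB'
    rw [Finset.mem_filter, mem_coverPreimages] at hB'
    exact req_le_of_thin hG hd (mem_thinMembers.2 ⟨hB'.1.1, hB'.2⟩)
  calc ∑ B' ∈ (coverPreimages M (Uq M (q + 2) q) G (insert z B)).filter (fun B' => B' ∉ lay0 M q G), req M q B'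
      ≤ ∑ _B' ∈ (coverPreimages M (Uq M (q + 2) q) G (insert z B)).filter (fun B' => B' ∉ lay0 M q G),
          phiQ q / ((q : ℚ) + 1) := Finset.sum_le_sum hterm
    _ = (((coverPreimages M (Uq M (q + 2) q) G (insert z B)).filter (fun B' => B' ∉ lay0 M q G)).card : ℚ) *
          (phiQ q / ((q : ℚ) + 1)) := by rw [Finset.sum_const, nsmul_eq_mul]
    _ ≤ (((B \ coloops M G).card : ℚ) + 1) * (phiQ q / ((q : ℚ) + 1)) := by
        apply mul_le_mul_of_nonneg_right _ (div_nonneg (phiQ_pos q).le (by positivity))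
        have h1 := Finset.card_le_card (coverPreimages_thin_subset_image hG hd' B z)
        have h2 := Finset.card_image_le (s := insert z (B \ coloops M G)) (f := fun w => (insert z B).erase w)
        have hzK : z ∉ B \ coloops M G := fun h => hzB (Finset.mem_sdiff.1 h).1
        rw [Finset.card_insert_of_notMem hzK] at h2
        exact_mod_cast h1.trans h2

/-- `λ > 0` for `q ≥ 2`. -/
theorem lambdaR_pos {q : ℕ} (hq : 2 ≤ q) : 0 < lambdaR q := by
  unfold lambdaR phiQ
  have hqq : (2 : ℚ) ≤ (q : ℚ) := by exact_mod_cast hq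
  have e : ((q : ℚ) + 2) / ((q : ℚ) + 1) / ((q : ℚ) + 1) - ((q : ℚ) + 4) / ((q : ℚ) * ((q : ℚ) + 1)) / 3 =
      (2 * (q : ℚ) ^ 2 + (q : ℚ) - 4) / (3 * (q : ℚ) * ((q : ℚ) + 1) ^ 2) := by
    field_simp
    ring
  rw [e]
  apply div_pos _ (by positivity)
  nlinarith

open scoped Classical in
/-- **Rigid cell: a pair loses at most `λ` at any covering set.**  (`|E ∖ G| = q − 1`, `kColoops + 2 = q`,
`|B ∖ K| = 2`.) -/
theorem loss_le_lambda {q : ℕ} {G : Finset α} (hG : G ∈ flatsQ M (q + 1)) (hd : (gr M \ G).card = q - 1)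
    (hk : kColoops M G + 2 = q) {B : Finset α} (hB : B ∈ thinMembers M q G)
    (h2 : (B \ coloops M G).card = 2) {z : α} (hz : z ∈ G \ clF M B) :
    loss M q G B z ≤ lambdaR q := by
  have hd' : (gr M \ G).card ≤ q := by omega
  have hB' : B ∈ membersIn M (Uq M (q + 2) q) G := (mem_thinMembers.1 hB).1
  have hBU : B ∈ Uq M (q + 2) q := (mem_membersIn.1 hB').1
  have hBG : clF M B ⊆ G := (mem_membersIn.1 hB').2
  have hSG : insert z B ⊆ G :=
    Finset.insert_subset (Finset.mem_sdiff.1 hz).1 ((subset_clF hBU).trans hBG)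
  have hq2 : 2 ≤ q := by omega
  set Φ' : ℚ := phiQ q / ((q : ℚ) + 1) with hΦ'
  set c : ℚ := ((q : ℚ) + 4) / ((q : ℚ) * ((q : ℚ) + 1)) with hc
  have hΦ'pos : 0 < Φ' := div_pos (phiQ_pos q) (by positivity)
  have hcpos : 0 < c := by rw [hc]; positivity
  have hreq : req M q B ≤ Φ' := req_le_of_thin hG hd hB
  have hreq0 : 0 ≤ req M q B := req_nonneg q B
  have hL1 : L1 M q G (insert z B) ≤ 3 * Φ' := by
    have := L1_insert_le hG hd hB hz
    rw [h2] at this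
    push_cast at this
    linarith
  -- capS (B ∪ z) ≥ c
  have hcap : c ≤ capS M q G (insert z B) := by
    have h1 : 1 - (kColoops M G : ℚ) * phiQ q / (1 + ((q : ℚ) - 1)) ≤ capS M q G (insert z B) := by
      unfold capS
      have hk1 : (k1 M q G (insert z B) : ℚ) ≤ (kColoops M G : ℚ) := by exact_mod_cast k1_le_kColoops hSG
      have hd1 : ((gr M \ G).card : ℚ) = (q : ℚ) - 1 := by
        rw [hd]; have : 1 ≤ q := by omega
        push_cast [Nat.cast_sub this]; ring
      rw [hd1]
      have hpos : (0 : ℚ) < 1 + ((q : ℚ) - 1) := by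
        have : (1 : ℚ) ≤ (q : ℚ) := by exact_mod_cast (by omega : 1 ≤ q)
        linarith
      apply sub_le_sub_left
      apply div_le_div_of_nonneg_right _ hpos.le
      exact mul_le_mul_of_nonneg_right hk1 (phiQ_pos q).le
    refine le_trans (le_of_eq ?_) h1
    -- 1 − (q−2)Φ/q = (q+4)/(q(q+1))
    have hkq : (kColoops M G : ℚ) = (q : ℚ) - 2 := by
      have : kColoops M G = q - 2 := by omega
      rw [this]; push_cast [Nat.cast_sub hq2]; ring
    rw [hkq, hc]
    unfold phiQ
    have hq0 : (q : ℚ) ≠ 0 := by exact_mod_cast (by omega : q ≠ 0)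
    have hq1 : (q : ℚ) + 1 ≠ 0 := by positivity
    have hq1' : (1 : ℚ) + ((q : ℚ) - 1) ≠ 0 := by
      rw [show (1 : ℚ) + ((q : ℚ) - 1) = (q : ℚ) by ring]; exact hq0
    rw [show (1 : ℚ) + ((q : ℚ) - 1) = (q : ℚ) by ring]
    field_simp
    ring
  -- the loss
  unfold loss fS
  split_ifs with hle
  · simp only [sub_self, mul_zero]
    exact (lambdaR_pos hq2).le
  · push Not at hle
    have hLpos : 0 < L1 M q G (insert z B) := hcpos.trans (hcap.trans_lt hle)
    -- req · (1 − cap/L1) ≤ Φ' · (1 − c/(3Φ')) = λ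
    have hfrac : c / (3 * Φ') ≤ capS M q G (insert z B) / L1 M q G (insert z B) := by
      rw [div_le_div_iff₀ (by positivity) hLpos]
      calc c * L1 M q G (insert z B) ≤ c * (3 * Φ') := mul_le_mul_of_nonneg_left hL1 hcpos.le
        _ ≤ capS M q G (insert z B) * (3 * Φ') := mul_le_mul_of_nonneg_right hcap (by positivity)
    have h1 : 1 - capS M q G (insert z B) / L1 M q G (insert z B) ≤ 1 - c / (3 * Φ') := by linarith
    have h1' : 0 ≤ 1 - capS M q G (insert z B) / L1 M q G (insert z B) := by
      rw [sub_nonneg, div_le_one hLpos]; exact hle.le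
    calc req M q B * (1 - capS M q G (insert z B) / L1 M q G (insert z B))
        ≤ Φ' * (1 - c / (3 * Φ')) := mul_le_mul hreq h1 h1' hΦ'pos.le
      _ = lambdaR q := by
          unfold lambdaR
          rw [← hΦ', ← hc]
          field_simp

end PercRepro.Shadow
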